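import Literature.AlgebraicGeometry.Motives.JacobianThetaDivisorUniq
import Literature.AlgebraicGeometry.Motives.JacobianAbelJacobiSum
import Literature.AlgebraicGeometry.Motives.AbelianVarietyCube
import HarnessLib

/-!
# Road G4, Step I transport: (3a′) from Milne's normalised Lemma 6.7 (M″), the symmetry of `W̃_{g−1}` (SYM) and Abel's theorem
# ([Lange2023] §4.4.2 Lemma 4.4.4 Step I / [Milne1986] §6 Lemma 6.7 — translations, base point, and the inversion `(−1)`)

Layer `Literature/AlgebraicGeometry/Motives`, namespace `Literature.AlgebraicGeometry.Motives.Jacobian`.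
KERNEL ONLY: theorems; no definition, no named fact, no instance, no `sorry`.  CONDITIONAL «of-leaves» file in the device of the cell
`hodgecm-mathlib` (D-0151) road-G4 pen (A-p04 (g17) PEN RULING #6 (d), sockets v5 §3′): the three next-run leaves enter as HYPOTHESES
of exactly the letter shapes — (M″) `exists_open_ajSum_classPullback_shear` (A-p02 (g15), `Motives/JacobianStepOneOfLeaves` HEAD),
(SYM) `exists_preimage_neg_brillNoetherLocus_eq` (A-p12 (g10)), ABEL (g4-1e) `ajSum_congr_linEquiv` (A-p18 (g13) / A-p02) — and the
CONSUMER letter (3a′) `exists_open_ajSum_classPullback_translate` comes out, so the pen skeleton's `stub_stepI` closes modulo exactly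
{(M″), (SYM), ABEL}.  (The letter's fourth input (DEG) ★ `AbelianVarietyWeilDivisorClassPullbackDegree` is NOT needed: instead of changing the
base point of the Abel–Jacobi sum we RE-CENTRE the Brill–Noether locus, `W̃(P′) = t_z(W̃(c))` ★ `brillNoetherLocus_eq_image_translation`.)

## The mathematics

Data: a Jacobian `𝒥` of a smooth projective complex curve `C` (`dim J ≥ 1`), a base point `c ∈ C(ℂ)`, a Riemann theta divisor `Θ`
(`supp Θ = t_{x₀}(W̃_{g−1}(P′))`, ★ `IsRiemannThetaDivisor`) which is a PRINCIPAL polarisation divisor.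
1. Re-centre: `supp Θ = t_{x₁}(W̃(c))` with `x₁ = x₀·z`; the translate `Θ₀ := t_{x₁}^*Θ` is effective, principal (★ `pullback_translation`)
   with `supp Θ₀ = W̃(c)` EXACTLY — the hypotheses of (M″) at the base point `c`.
2. (SYM) «`(−1)⁻¹ W̃(c) = t_κ⁻¹ W̃(c)`» upgrades to DIVISORS: `(−1)^*Θ₀ ≈ t_κ^*Θ₀` — both are effective principal polarisation divisors with
   the same IRREDUCIBLE support, hence the same multiple-one of its prime divisor (★ p765317 `exists_sameDivisor_smul_of_support_eq` + ★ p765111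
   `eq_one_of_isPrincipalPolarizationDivisor_smul`, exactly as in ★ p765558 `weilPairingLevel_eq_of_isRiemannThetaDivisor_of_mult`).
3. Milne's shear `ι_a = t_a ∘ (−1) ∘ α_c`: `((−1) ≫ t_a)^*Θ₀ = (t_{a⁻¹} ≫ (−1))^*Θ₀ ≈ t_{a⁻¹}^*(t_κ^*Θ₀) = t_{κa⁻¹}^*Θ₀` (★ `translation_left_comp_toSchemeHom`,
   ★ `translation_comp`), while `t_x^*Θ ≈ t_x^* t_{x₁⁻¹}^* Θ₀ = t_{x₁⁻¹x}^*Θ₀`; with `a := x⁻¹·x₁·κ` the two agree, so (M″) «`aj_c(ι_a^♮Θ₀) = a`»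
   reads `aj_c(α_c^♮(t_x^*Θ)) = (x₁κ)·x⁻¹` for `a ∈ U₀(ℂ)`, i.e. for `x` in the non-empty open `U := ((−1) ≫ t_{x₁κ})⁻¹ U₀` (ABEL moves `aj_c`
   across the linear equivalences of ★ `classPullback_comp_linEquiv` / `classPullback_linEquiv_pullback`).

COUNT-NEUTRAL capital; HC_CM is proved only modulo the 7 printed citations until rung 0 closes.

## References
* [Lange2023AbelianVarietiesComplex] H. Lange, *Abelian Varieties over the Complex Numbers* (2023), §4.4.2 Lemma 4.4.4 (Step I) and Cor. 4.4.5;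
  §4.1.3 (base point), §4.2.1 Lemma 4.2.1 / Cor. 4.2.4 (translates of `W̃_{g−1}`, theta divisors).
* [Milne1986JacobianVarieties] J. S. Milne, *Jacobian Varieties* (1986), §6 Lemma 6.7 (p. 187: `(f^{(g)})⁻¹(Θ⁻_a) = D(a)`, `Θ⁻ = (−1)^*Θ`) and the
  remark before Thm. 6.6 (`W^{g−1}` and its translates).
* [MumfordAV1970] D. Mumford, *Abelian Varieties* (1970), §4 (translations, Cor. 1 of the rigidity lemma), §6 Cor. 4.
* [Hartshorne1977] R. Hartshorne, *Algebraic Geometry* (1977), II Prop. 6.11 and Remark 6.11.2 (pp. 141–142).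
-/

set_option autoImplicit false

noncomputable section

universe u

open CategoryTheory CategoryTheory.Limits AlgebraicGeometry
open scoped MonObj

namespace Literature.AlgebraicGeometry.Motives

namespace Jacobian

variable {k : Type u} [Field k] {C : SchemeOver k} (𝒥 : Jacobian C)

/-! ## §1 Translations on the underlying space (bookkeeping) -/

/-- `t_a(t_b(S)) = t_{ab}(S)` on subsets (★ `translation_comp`). [cite: MumfordAV1970, §4 (translations)] -/
theorem image_translation_image_translation (a b : 𝒥.J.Points k) (S : Set 𝒥.J.X.left) :
    (𝒥.J.translation a).left.base '' ((𝒥.J.translation b).left.base '' S) = (𝒥.J.translation (a * b)).left.base '' S := by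
  rw [Set.image_image, ← 𝒥.J.translation_comp b a]
  rfl

/-- `t_a(S) = t_{a⁻¹}⁻¹(S)` (the translation `t_a` is a bijection with inverse `t_{a⁻¹}`). [cite: MumfordAV1970, §4 (translations)] -/
theorem image_translation_eq_preimage (a : 𝒥.J.Points k) (S : Set 𝒥.J.X.left) :
    (𝒥.J.translation a).left.base '' S = (𝒥.J.translation a⁻¹).left.base ⁻¹' S := by
  have h1 : Function.LeftInverse (𝒥.J.translation a⁻¹).left.base (𝒥.J.translation a).left.base := fun p => by
    change ((𝒥.J.translation a).left ≫ (𝒥.J.translation a⁻¹).left).base p = p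
    rw [← Over.comp_left, 𝒥.J.translation_comp_translation_inv a]; rfl
  have h2 : Function.RightInverse (𝒥.J.translation a⁻¹).left.base (𝒥.J.translation a).left.base := fun p => by
    change ((𝒥.J.translation a⁻¹).left ≫ (𝒥.J.translation a).left).base p = p
    rw [← Over.comp_left, 𝒥.J.translation_inv_comp_translation a]; rfl
  exact congrFun (Set.image_eq_preimage_of_inverse h1 h2) S

/-- `t_a⁻¹(t_a(S)) = S`. [cite: MumfordAV1970, §4 (translations)] -/
theorem preimage_translation_image_translation (a : 𝒥.J.Points k) (S : Set 𝒥.J.X.left) :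
    (𝒥.J.translation a).left.base ⁻¹' ((𝒥.J.translation a).left.base '' S) = S := by
  rw [𝒥.image_translation_eq_preimage, ← Set.preimage_comp]
  change ((𝒥.J.translation a).left ≫ (𝒥.J.translation a⁻¹).left).base ⁻¹' S = S
  rw [← Over.comp_left, 𝒥.J.translation_comp_translation_inv a]
  rfl

variable {𝒥} in
/-- **The support of a Riemann theta divisor, RE-CENTRED at any base point**: `supp Θ = t_{x₁}(W̃_{dim J−1}(c))` for some `x₁ ∈ J(k)`
(★ `brillNoetherLocus_eq_image_translation`: all `W̃(P)` are translates of each other). [cite: Lange2023AbelianVarietiesComplex, §4.2.1 Cor. 4.2.4 and §4.1.3] -/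
theorem IsRiemannThetaDivisor.exists_support_eq_image_translation {Θ : CartierDivisor 𝒥.J.X.left} (h : 𝒥.IsRiemannThetaDivisor Θ)
    (c : AlgPoints C k) :
    ∃ x₁ : 𝒥.J.Points k, (Θ.nonvanishing 1)ᶜ = (𝒥.J.translation x₁).left.base '' 𝒥.brillNoetherLocus c (𝒥.J.dim - 1) := by
  obtain ⟨P', x₀, hsupp⟩ := h.exists_support_eq
  refine ⟨x₀ * ((P' ≫ 𝒥.abelJacobi c : 𝒥.J.Points k))⁻¹ ^ (𝒥.J.dim - 1), ?_⟩
  rw [hsupp, 𝒥.brillNoetherLocus_eq_image_translation c P', image_translation_image_translation]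

/-! ## §2 The inversion `(−1)` and translates -/

/-- `(−1) ≫ t_a = t_{a⁻¹} ≫ (−1)` on the underlying schemes (homomorphisms intertwine translations, ★ `translation_left_comp_toSchemeHom`,
and `(−1)(a⁻¹) = a`). [cite: MumfordAV1970, §4 (Cor. 1 of the rigidity lemma)] -/
theorem toSchemeHom_negOne_comp_translation (a : 𝒥.J.Points k) :
    AbelianVariety.Hom.toSchemeHom ((-1 : ℤ) • 𝟙 𝒥.J) ≫ (𝒥.J.translation a).left =
      (𝒥.J.translation a⁻¹).left ≫ AbelianVariety.Hom.toSchemeHom ((-1 : ℤ) • 𝟙 𝒥.J) := by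
  have h := AbelianVariety.translation_left_comp_toSchemeHom ((-1 : ℤ) • 𝟙 𝒥.J) a⁻¹
  have ha : AlgPoints.map ((-1 : ℤ) • 𝟙 𝒥.J).hom.hom.hom a⁻¹ = a := by
    rw [AlgPoints.map_apply]
    change a⁻¹ ≫ 𝒥.J.zsmulPt (-1) = a
    rw [AbelianVariety.comp_zsmulPt_neg_one, inv_inv]
  rw [ha] at h
  exact h.symm

/-- `(−1)` is an involution of `J`: `((−1) • 𝟙) ≫ ((−1) • 𝟙) = 𝟙`. [cite: MumfordAV1970, §4] -/
theorem negOne_zsmul_id_comp_self : ((-1 : ℤ) • 𝟙 𝒥.J) ≫ ((-1 : ℤ) • 𝟙 𝒥.J) = 𝟙 𝒥.J := by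
  rw [Preadditive.zsmul_comp, Preadditive.comp_zsmul, Category.comp_id, smul_smul]
  norm_num

/-- `(−1) • 𝟙_J` is an isomorphism of abelian varieties. [cite: MumfordAV1970, §4] -/
theorem isIso_negOne_zsmul_id : IsIso ((-1 : ℤ) • 𝟙 𝒥.J) :=
  ⟨⟨(-1 : ℤ) • 𝟙 𝒥.J, 𝒥.negOne_zsmul_id_comp_self, 𝒥.negOne_zsmul_id_comp_self⟩⟩

/-- The underlying scheme morphism of `(−1) • 𝟙_J` is dominant (it is an isomorphism). [cite: MumfordAV1970, §4] -/
theorem isDominant_toSchemeHom_negOne : IsDominant (AbelianVariety.Hom.toSchemeHom ((-1 : ℤ) • 𝟙 𝒥.J)) := by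
  change IsDominant (𝒥.J.zsmulPt (-1)).left
  exact ⟨(Scheme.homeoOfIso (asIso (𝒥.J.zsmulPt (-1)).left)).surjective.denseRange⟩

end Jacobian

/-! ## §3 Two principal polarisation divisors with the same irreducible support are the same divisor -/

namespace AbelianVariety

/-- **Two effective PRINCIPAL polarisation divisors with the same irreducible support coincide as divisors** (complex abelian variety of
positive dimension): each is `mᵢ • D` for the prime divisor `D` of the support (★ `exists_sameDivisor_smul_of_support_eq`, Hartshorne II 6.11)
and principality forces `mᵢ = 1` (★ `eq_one_of_isPrincipalPolarizationDivisor_smul`).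
[cite: Hartshorne1977, II.6 Prop. 6.11 and Remark 6.11.2 (pp. 141–142)] [cite: Lange2023AbelianVarietiesComplex, §4.1.2 Prop. 4.1.2 and §4.2.1 Cor. 4.2.4] -/
theorem IsPrincipalPolarizationDivisor.sameDivisor_of_support_eq (A : AbelianVariety ℂ) (hA : 1 ≤ A.dim)
    {E₁ E₂ : CartierDivisor A.X.left} (h₁ : E₁.IsEffective) (h₂ : E₂.IsEffective)
    (hp₁ : A.IsPrincipalPolarizationDivisor E₁) (hp₂ : A.IsPrincipalPolarizationDivisor E₂)
    (hsupp : (E₁.nonvanishing 1)ᶜ = (E₂.nonvanishing 1)ᶜ) (hirr : IsIrreducible (E₁.nonvanishing 1)ᶜ) :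
    E₁.SameDivisor E₂ := by
  obtain ⟨D, m₁, m₂, hm₁, hm₂, hE₁, hE₂⟩ := A.exists_sameDivisor_smul_of_support_eq E₁ E₂ h₁ h₂ hsupp hirr
  have e₁ : m₁ = 1 := A.eq_one_of_isPrincipalPolarizationDivisor_smul hA D hm₁.ne' (hp₁.congr_sameDivisor hE₁)
  have e₂ : m₂ = 1 := A.eq_one_of_isPrincipalPolarizationDivisor_smul hA D hm₂.ne' (hp₂.congr_sameDivisor hE₂)
  rw [e₁, CartierDivisor.one_smul] at hE₁
  rw [e₂, CartierDivisor.one_smul] at hE₂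
  exact hE₁.trans hE₂.symm

end AbelianVariety

/-! ## §4 The transport -/

namespace Jacobian

variable {C : SchemeOver ℂ} [IsIntegral C.left] [IsLocallyNoetherian C.left]

omit [IsIntegral C.left] [IsLocallyNoetherian C.left] in
/-- **(SYM) on DIVISORS**: for an effective principal polarisation divisor `Θ₀` with support EXACTLY `W̃_{dim J−1}(c)` and `κ` with
`(−1)⁻¹ W̃(c) = t_κ⁻¹ W̃(c)` (the letter (SYM)), `(−1)^*Θ₀ ≈ t_κ^*Θ₀` — both pull-backs are effective principal polarisation divisors
(★ `pullback_of_isIso`, ★ `pullback_translation`) with the same irreducible support `t_κ⁻¹ W̃(c) = t_{κ⁻¹}(W̃(c))` (§3).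
[cite: Milne1986JacobianVarieties, §6 Lemma 6.7 (Θ⁻ = (−1)^*Θ)] [cite: Lange2023AbelianVarietiesComplex, §4.2.1 Cor. 4.2.4] -/
theorem pullback_negOne_sameDivisor_pullback_translation (hC : IsSmoothProjective 1 C) (𝒥 : Jacobian C) (hdim : 1 ≤ 𝒥.J.dim)
    (c : AlgPoints C ℂ) {Θ₀ : CartierDivisor 𝒥.J.X.left} (h0 : Θ₀.IsEffective)
    (hsupp : (Θ₀.nonvanishing 1)ᶜ = 𝒥.brillNoetherLocus c (𝒥.J.dim - 1)) (hpr : 𝒥.J.IsPrincipalPolarizationDivisor Θ₀)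
    {κ : 𝒥.J.Points ℂ}
    (hκ : (AbelianVariety.Hom.toSchemeHom ((-1 : ℤ) • 𝟙 𝒥.J)).base ⁻¹' 𝒥.brillNoetherLocus c (𝒥.J.dim - 1) =
      (𝒥.J.translation κ).left.base ⁻¹' 𝒥.brillNoetherLocus c (𝒥.J.dim - 1)) :
    haveI := 𝒥.isDominant_toSchemeHom_negOne
    (Θ₀.pullback (AbelianVariety.Hom.toSchemeHom ((-1 : ℤ) • 𝟙 𝒥.J))).SameDivisor (Θ₀.pullback (𝒥.J.translation κ).left) := by
  haveI := 𝒥.isDominant_toSchemeHom_negOne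
  haveI := 𝒥.isIso_negOne_zsmul_id
  haveI := hC.geometricallyIrreducible
  have hs₁ : ((Θ₀.pullback (AbelianVariety.Hom.toSchemeHom ((-1 : ℤ) • 𝟙 𝒥.J))).nonvanishing 1)ᶜ =
      (𝒥.J.translation κ).left.base ⁻¹' 𝒥.brillNoetherLocus c (𝒥.J.dim - 1) := by
    rw [h0.compl_nonvanishing_one_pullback, hsupp, hκ]
  have hs₂ : ((Θ₀.pullback (𝒥.J.translation κ).left).nonvanishing 1)ᶜ =
      (𝒥.J.translation κ).left.base ⁻¹' 𝒥.brillNoetherLocus c (𝒥.J.dim - 1) := by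
    rw [h0.compl_nonvanishing_one_pullback, hsupp]
  have hirr : IsIrreducible ((Θ₀.pullback (AbelianVariety.Hom.toSchemeHom ((-1 : ℤ) • 𝟙 𝒥.J))).nonvanishing 1)ᶜ := by
    rw [hs₁, ← inv_inv κ, ← 𝒥.image_translation_eq_preimage κ⁻¹]
    exact 𝒥.isIrreducible_image_translation_brillNoetherLocus c _ κ⁻¹
  exact AbelianVariety.IsPrincipalPolarizationDivisor.sameDivisor_of_support_eq 𝒥.J hdim (h0.pullback _) (h0.pullback _)
    (hpr.pullback_of_isIso _) (hpr.pullback_translation κ) (hs₁.trans hs₂.symm) hirr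

/-- **ROAD G4, STEP I TRANSPORT — the consumer letter (3a′) from the leaves (M″), (SYM), ABEL.**  For a Jacobian `𝒥` of a smooth projective
complex curve with `dim J ≥ 1`, a base point `c`, and the three leaves AT THAT BASE POINT as hypotheses — (M″) Milne's normalised Lemma 6.7
«`aj_c(ι_a^♮ Θ₀) = a` on a non-empty open, for every effective principal `Θ₀` with `supp Θ₀ = W̃_{dim J−1}(c)`, `ι_a = t_a ∘ (−1) ∘ α_c`», (SYM)
«`(−1)⁻¹ W̃(c) = t_κ⁻¹ W̃(c)`», ABEL «`aj_c` is constant on linear equivalence classes» — every Riemann theta divisor `Θ` which is a principal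
polarisation divisor satisfies (3a′): **there are a non-empty open `U ⊆ J` and `κ′ ∈ J(ℂ)` with `aj_c(α_c^♮(t_x^*Θ)) = κ′ · x⁻¹` for all
`x ∈ J(ℂ)` whose point lies in `U`.**  [Lange2023] Lemma 4.4.4 Step I (translations, base point, `(−1)^*Θ`), [Milne1986] Lemma 6.7.
[cite: Lange2023AbelianVarietiesComplex, §4.4.2 Lemma 4.4.4 and Cor. 4.4.5] [cite: Milne1986JacobianVarieties, §6 Lemma 6.7] -/
theorem exists_open_ajSum_classPullback_translate_of_leaves (hC : IsSmoothProjective 1 C) (𝒥 : Jacobian C) (hdim : 1 ≤ 𝒥.J.dim)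
    (c : AlgPoints C ℂ)
    (hM : ∀ (Θ₀ : CartierDivisor 𝒥.J.X.left), Θ₀.IsEffective →
      (Θ₀.nonvanishing 1)ᶜ = 𝒥.brillNoetherLocus c (𝒥.J.dim - 1) → 𝒥.J.IsPrincipalPolarizationDivisor Θ₀ →
      ∃ U : 𝒥.J.X.left.Opens, (U : Set 𝒥.J.X.left).Nonempty ∧
        ∀ a : 𝒥.J.Points ℂ, a.pt ∈ U →
          𝒥.ajSum c (Θ₀.classPullback ((𝒥.abelJacobi c).left ≫
            AbelianVariety.Hom.toSchemeHom ((-1 : ℤ) • 𝟙 𝒥.J) ≫ (𝒥.J.translation a).left)) = a)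
    (hS : ∃ κ : 𝒥.J.Points ℂ,
      (AbelianVariety.Hom.toSchemeHom ((-1 : ℤ) • 𝟙 𝒥.J)).base ⁻¹' 𝒥.brillNoetherLocus c (𝒥.J.dim - 1) =
        (𝒥.J.translation κ).left.base ⁻¹' 𝒥.brillNoetherLocus c (𝒥.J.dim - 1))
    (hA : ∀ {E F : CartierDivisor C.left}, E.LinEquiv F → 𝒥.ajSum c E = 𝒥.ajSum c F)
    {Θ : CartierDivisor 𝒥.J.X.left} (h1 : 𝒥.IsRiemannThetaDivisor Θ) (h2 : 𝒥.J.IsPrincipalPolarizationDivisor Θ) :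
    ∃ U : 𝒥.J.X.left.Opens, (U : Set 𝒥.J.X.left).Nonempty ∧ ∃ κ' : 𝒥.J.Points ℂ,
      ∀ x : 𝒥.J.Points ℂ, x.pt ∈ U →
        𝒥.ajSum c ((Θ.pullback (𝒥.J.translation x).left).classPullback (𝒥.abelJacobi c).left) = κ' * x⁻¹ := by
  haveI := 𝒥.isDominant_toSchemeHom_negOne
  -- Step 1: re-centre the support at `c` and translate `Θ` back: `Θ₀ := t_{x₁}^* Θ`, `supp Θ₀ = W̃(c)`
  obtain ⟨x₁, hsuppΘ⟩ := h1.exists_support_eq_image_translation c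
  set Θ₀ : CartierDivisor 𝒥.J.X.left := Θ.pullback (𝒥.J.translation x₁).left with hΘ₀
  have h0 : Θ₀.IsEffective := h1.isEffective.pullback _
  have hsupp₀ : (Θ₀.nonvanishing 1)ᶜ = 𝒥.brillNoetherLocus c (𝒥.J.dim - 1) := by
    rw [hΘ₀, h1.isEffective.compl_nonvanishing_one_pullback, hsuppΘ, preimage_translation_image_translation]
  have hpr₀ : 𝒥.J.IsPrincipalPolarizationDivisor Θ₀ := h2.pullback_translation x₁
  -- `Θ ≈ t_{x₁⁻¹}^* Θ₀`
  have hΘback : Θ.SameDivisor (Θ₀.pullback (𝒥.J.translation x₁⁻¹).left) := by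
    refine CartierDivisor.SameDivisor.symm ?_
    refine (CartierDivisor.pullback_pullback_sameDivisor (D := Θ) _ _).trans ?_
    refine (CartierDivisor.pullback_congr_sameDivisor (D := Θ) (g₂ := 𝟙 _)
      (by rw [← Over.comp_left, 𝒥.J.translation_inv_comp_translation x₁, Over.id_left])).trans ?_
    exact CartierDivisor.pullback_id_sameDivisor (D := Θ)
  -- Step 2: the leaves
  obtain ⟨U₀, hU₀, hMU⟩ := hM Θ₀ h0 hsupp₀ hpr₀
  obtain ⟨κ, hκ⟩ := hS
  have hsym := 𝒥.pullback_negOne_sameDivisor_pullback_translation hC hdim c h0 hsupp₀ hpr₀ hκ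
  -- Step 3: the open set `U := ((−1) ≫ t_{x₁ κ})⁻¹ U₀` and the constant `κ′ := x₁ κ`
  set φ : 𝒥.J.X.left ⟶ 𝒥.J.X.left :=
    AbelianVariety.Hom.toSchemeHom ((-1 : ℤ) • 𝟙 𝒥.J) ≫ (𝒥.J.translation (x₁ * κ)).left with hφ
  refine ⟨φ ⁻¹ᵁ U₀, ?_, x₁ * κ, fun x hx => ?_⟩
  · -- non-empty: `φ` is surjective (an automorphism)
    obtain ⟨p, hp⟩ := hU₀
    haveI : IsIso φ := by rw [hφ]; change IsIso ((𝒥.J.zsmulPt (-1)).left ≫ _); infer_instance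
    obtain ⟨q, rfl⟩ := (Scheme.homeoOfIso (asIso φ)).surjective p
    exact ⟨q, hp⟩
  · -- the point `a := x⁻¹ · x₁ · κ` has `a.pt = φ(x.pt) ∈ U₀`
    set a : 𝒥.J.Points ℂ := x⁻¹ * (x₁ * κ) with ha
    have hapt : a.pt = φ.base x.pt := by
      rw [hφ, Scheme.Hom.comp_base, TopCat.coe_comp, Function.comp_apply]
      change a.pt = (𝒥.J.translation (x₁ * κ)).left ((𝒥.J.zsmulPt (-1)).left (AlgPoints.pt x))
      rw [AbelianVariety.zsmulPt_neg_one_apply_pt, AbelianVariety.translation_apply_pt, ha, mul_comm]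
    have haU : a.pt ∈ U₀ := by rw [hapt]; exact hx
    have hmain := hMU a haU
    -- Step 4: both divisors are linearly equivalent to `α_c^♮ (t_{x₁⁻¹ x}^* Θ₀)`
    -- (4a) the (M″) side: `Θ₀^♮ along α_c ≫ (−1) ≫ t_a`
    set ψ : 𝒥.J.X.left ⟶ 𝒥.J.X.left :=
      AbelianVariety.Hom.toSchemeHom ((-1 : ℤ) • 𝟙 𝒥.J) ≫ (𝒥.J.translation a).left with hψ
    haveI : IsDominant ψ := by rw [hψ]; infer_instance
    have hψ' : ψ = (𝒥.J.translation a⁻¹).left ≫ AbelianVariety.Hom.toSchemeHom ((-1 : ℤ) • 𝟙 𝒥.J) :=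
      𝒥.toSchemeHom_negOne_comp_translation a
    haveI : IsDominant ((𝒥.J.translation a⁻¹).left ≫ AbelianVariety.Hom.toSchemeHom ((-1 : ℤ) • 𝟙 𝒥.J)) := inferInstance
    haveI : IsDominant ((𝒥.J.translation a⁻¹).left ≫ (𝒥.J.translation κ).left) := inferInstance
    -- `ψ^* Θ₀ ≈ t_{κ a⁻¹}^* Θ₀`
    have hL : (Θ₀.pullback ψ).SameDivisor (Θ₀.pullback (𝒥.J.translation (κ * a⁻¹)).left) := by
      refine (Θ₀.pullback_congr_sameDivisor hψ').trans ?_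
      refine (CartierDivisor.pullback_pullback_sameDivisor (D := Θ₀) _ _).symm.trans ?_
      refine (hsym.pullback _).trans ?_
      refine (CartierDivisor.pullback_pullback_sameDivisor (D := Θ₀) _ _).trans ?_
      exact CartierDivisor.pullback_congr_sameDivisor (D := Θ₀) (by rw [← Over.comp_left, 𝒥.J.translation_comp])
    -- (4b) the (3a′) side: `t_x^* Θ ≈ t_{x₁⁻¹ x}^* Θ₀`
    haveI : IsDominant ((𝒥.J.translation x).left ≫ (𝒥.J.translation x₁⁻¹).left) := inferInstance
    have hR : (Θ.pullback (𝒥.J.translation x).left).SameDivisor (Θ₀.pullback (𝒥.J.translation (x₁⁻¹ * x)).left) := by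
      refine (hΘback.pullback _).trans ?_
      refine (CartierDivisor.pullback_pullback_sameDivisor (D := Θ₀) _ _).trans ?_
      exact CartierDivisor.pullback_congr_sameDivisor (D := Θ₀) (by rw [← Over.comp_left, 𝒥.J.translation_comp])
    -- the two translation parameters agree: `κ · a⁻¹ = x₁⁻¹ · x`
    have hpar : κ * a⁻¹ = x₁⁻¹ * x := by
      rw [ha, mul_inv_rev, mul_inv_rev, inv_inv]
      rw [← mul_assoc, ← mul_assoc, mul_inv_cancel, one_mul]
    rw [hpar] at hL
    -- Step 5: move `aj_c` across the linear equivalences (ABEL)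
    have hcomp : (Θ₀.classPullback ((𝒥.abelJacobi c).left ≫ ψ)).LinEquiv
        ((Θ₀.pullback (𝒥.J.translation (x₁⁻¹ * x)).left).classPullback (𝒥.abelJacobi c).left) :=
      (Θ₀.classPullback_comp_linEquiv ψ (𝒥.abelJacobi c).left).trans
        (((Θ₀.classPullback_linEquiv_pullback ψ).trans hL.linEquiv).classPullback _)
    have hcomp' : ((Θ.pullback (𝒥.J.translation x).left).classPullback (𝒥.abelJacobi c).left).LinEquiv
        ((Θ₀.pullback (𝒥.J.translation (x₁⁻¹ * x)).left).classPullback (𝒥.abelJacobi c).left) :=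
      hR.linEquiv.classPullback _
    rw [hA hcomp', ← hA hcomp]
    change 𝒥.ajSum c (Θ₀.classPullback ((𝒥.abelJacobi c).left ≫ ψ)) = (x₁ * κ) * x⁻¹
    rw [hψ, hmain, ha, mul_comm]

end Jacobian

end Literature.AlgebraicGeometry.Motives

end
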